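import Summits.QuantumFields.GaugeBoot.Eqs.BindKitN
import HarnessLib

/-!
# Generic binding kit, ℕ-keyed with INTEGER coefficients (`BindZ`): the equality-row check without rational arithmetic

Cell `pub-gaugeboot` (HOME `run/shared/lean/pub/pub-gaugeboot/`), seat lean2 (binding engine; FANOUT-PLAN A126 (2) / A137 (1) sequels).
`Eqs/BindKitN` checks a coded equality row of a certified problem file against its combination of the family's G1 theorem rows
by comparing merge-sort canonical forms of `ℕ`-keyed rows with RATIONAL coefficients; most of its kernel time is rational
arithmetic (every `+`/`·` normalises by a `gcd`).  This kit performs the same comparison over INTEGERS: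
* a G1 theorem row is stored as `LitZ` = `(label code, 4·c0, c1)` (for every family of the cell `4·c0 ∈ ℤ`, `c1 ∈ ℤ`; coefficient
  `c0 + c1·β/8`), and at `β_std = p/q` it is evaluated to the integer row `evalZ p q` = `(code, 8q·(4c0) + 4p·c1)` = `32q ×` its value;
* a problem row is stored as `(terms (code, z), M, K, witness (m, def id, position))` with decoded coefficient `z / M`, an integer
  scale `K ≠ 0` and INTEGER witness multipliers `m` (the generator clears denominators: `K·M·row = Σ m_j · 32q·lit_j(β)`);
* `cchkZ litZ p q c` = `K ≠ 0 ∧ mcanon (K • terms) = mcanon (Σ_j m_j • evalZ p q (litZ j))` — integer additions / multiplications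
  and natural-number comparisons only (`ZRow.mcanon`: fuelled merge sort, equal keys added, zeros dropped);
* `rowVal_decWZ_eq_zero_of_cchkZ` — SOUNDNESS for any valuation `W : Word d → ℝ`: if every decoded literal row vanishes under `W`
  at `β₀ = p/q` (`q ≠ 0`) and the check passes, the decoded problem row `decWZ d terms M` vanishes under `W` at `β₀`.
Label codes / decoding (`wdg`, `decRowQ`) are those of `Eqs/BindKitN`.  Nothing here is a certificate replay.

HONEST FRAMING (page 1 of every file of this cell): certified bounds on lattice expectations at STATED coupling, gauge
group, dimension and torus size; NOT a mass gap, NOT a continuum limit, NOT a string tension, NOT large `N`; NOT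
Yang–Mills-summit-bearing (barriers `FixedCouplingUltralocality`, `PerturbativeInvisibility`).
-/

noncomputable section

open Literature.MathematicalPhysics.QuantumFieldTheory
open Summit.QuantumFields.GaugeBoot.BindN

namespace Summit.QuantumFields.GaugeBoot.BindZ

/-! ## Integer rows keyed by label codes and their merge-sort canonical form -/

/-- An integer-coefficient row keyed by label codes. -/
abbrev ZRow : Type := List (ℕ × ℤ)

/-- Fuelled merge: equal codes meeting at the heads are added; out of fuel ↦ concatenate. -/
def ZRow.mergeF : ℕ → ZRow → ZRow → ZRow
  | 0, l, r => l ++ r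
  | _ + 1, [], r => r
  | _ + 1, t :: l, [] => t :: l
  | n + 1, t :: l, u :: r =>
      if t.1 = u.1 then (t.1, t.2 + u.2) :: ZRow.mergeF n l r
      else if t.1 < u.1 then t :: ZRow.mergeF n l (u :: r) else u :: ZRow.mergeF n (t :: l) r

/-- Fuelled merge sort (fuel = recursion depth; out of fuel ↦ unchanged). -/
def ZRow.msortF : ℕ → ZRow → ZRow
  | 0, r => r
  | _ + 1, [] => []
  | _ + 1, [t] => [t]
  | n + 1, t :: u :: r =>
      ZRow.mergeF (r.length + 2) (ZRow.msortF n ((t :: u :: r).take (r.length / 2 + 1)))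
        (ZRow.msortF n ((t :: u :: r).drop (r.length / 2 + 1)))

/-- Canonical form: sorted by code, equal codes merged, zero coefficients dropped. -/
def ZRow.mcanon (r : ZRow) : ZRow := (ZRow.msortF r.length r).filter fun t => t.2 ≠ 0

/-- The value of an integer row under a valuation of the codes. -/
def zval (v : ℕ → ℝ) (r : ZRow) : ℝ := (r.map fun t => (t.2 : ℝ) * v t.1).sum

variable (v : ℕ → ℝ)

/-- Unfolding lemma. -/
@[simp] theorem zval_nil : zval v [] = 0 := rfl

/-- Unfolding lemma. -/
@[simp] theorem zval_cons (t : ℕ × ℤ) (r : ZRow) : zval v (t :: r) = (t.2 : ℝ) * v t.1 + zval v r := by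
  simp [zval]

/-- `zval` is additive under concatenation. -/
@[simp] theorem zval_append (r s : ZRow) : zval v (r ++ s) = zval v r + zval v s := by
  simp [zval, List.sum_append]

/-- The merge has the value of the two rows together (every fuel). -/
theorem zval_mergeF (n : ℕ) (l r : ZRow) : zval v (ZRow.mergeF n l r) = zval v l + zval v r := by
  induction n generalizing l r with
  | zero => simp [ZRow.mergeF]
  | succ n ih =>
    cases l with
    | nil => simp [ZRow.mergeF]
    | cons t l =>
      cases r with
      | nil => simp [ZRow.mergeF]
      | cons u r =>
        simp only [ZRow.mergeF]
        split_ifs with h1 h2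
        · rw [zval_cons, ih, zval_cons, zval_cons, h1]; push_cast; ring
        · rw [zval_cons, ih, zval_cons, zval_cons]; ring
        · rw [zval_cons, ih, zval_cons, zval_cons]; ring

/-- The merge sort preserves the value (every fuel). -/
theorem zval_msortF (n : ℕ) (r : ZRow) : zval v (ZRow.msortF n r) = zval v r := by
  induction n generalizing r with
  | zero => rfl
  | succ n ih =>
    match r with
    | [] => rfl
    | [_] => rfl
    | t :: u :: r =>
      rw [ZRow.msortF, zval_mergeF, ih, ih, ← zval_append, List.take_append_drop]

/-- Dropping zero coefficients preserves the value. -/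
theorem zval_filter_ne_zero (r : ZRow) : zval v (r.filter fun t => t.2 ≠ 0) = zval v r := by
  induction r with
  | nil => simp
  | cons t r ih =>
    simp only [List.filter_cons] at ih ⊢
    split_ifs with h
    · simp only [zval_cons, ih]
    · simp only [decide_eq_true_eq, not_not] at h
      simp only [zval_cons, ih, h]; push_cast; ring

/-- **The canonical form has the same value.** -/
theorem zval_mcanon (r : ZRow) : zval v (ZRow.mcanon r) = zval v r := by
  unfold ZRow.mcanon
  rw [zval_filter_ne_zero, zval_msortF]

/-- Rows with equal canonical forms have equal values. -/
theorem zval_eq_of_mcanon_eq (r s : ZRow) (h : ZRow.mcanon r = ZRow.mcanon s) : zval v r = zval v s := by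
  rw [← zval_mcanon v r, h, zval_mcanon]

/-- Scale an integer row. -/
def ZRow.smul (a : ℤ) (r : ZRow) : ZRow := r.map fun t => (t.1, a * t.2)

/-- `zval (a • r) = a · zval r`. -/
theorem zval_smul (a : ℤ) (r : ZRow) : zval v (ZRow.smul a r) = (a : ℝ) * zval v r := by
  induction r with
  | nil => simp [ZRow.smul]
  | cons t r ih =>
    simp only [ZRow.smul, List.map_cons, zval_cons] at ih ⊢
    rw [ih]; push_cast; ring

/-- An integer linear combination of integer rows: the concatenation of the scaled rows (unmerged). -/
def ZRow.lincomb (cs : List (ℤ × ZRow)) : ZRow := (cs.map fun p => ZRow.smul p.1 p.2).flatten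

/-- **A linear combination of vanishing rows vanishes.** -/
theorem zval_lincomb_eq_zero (cs : List (ℤ × ZRow)) (h : ∀ p ∈ cs, zval v p.2 = 0) : zval v (ZRow.lincomb cs) = 0 := by
  induction cs with
  | nil => simp [ZRow.lincomb]
  | cons p cs ih =>
    have hp := h p (by simp)
    have ih' := ih fun q hq => h q (by simp [hq])
    simp only [ZRow.lincomb, List.map_cons, List.flatten_cons, zval_append] at ih' ⊢
    rw [zval_smul, hp, ih']; simp

/-! ## Coded literal theorem rows `(code, 4·c0, c1)` and their integer evaluation at `β = p/q` -/

/-- A coded literal theorem row: entries `(label code, 4·c0, c1)` (coefficient `c0 + c1·β/8`). -/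
abbrev LitZ : Type := List (ℕ × ℤ × ℤ)

/-- Entry constructor `(code, 4·c0, c1)` (fixes numeral types for fast elaboration). -/
def ez (w : ℕ) (a b : ℤ) : ℕ × ℤ × ℤ := (w, a, b)

/-- The rational (`ℕ`-keyed) row of a coded literal row: `(code, (4c0)/4, c1)`. -/
def litQ (r : LitZ) : GRow ℕ := r.map fun t => (t.1, (t.2.1 : ℚ) / 4, (t.2.2 : ℚ))

/-- Integer evaluation at `β = p/q`: `(code, 8q·(4c0) + 4p·c1)` = `32q ×` the coefficient `c0 + c1·(p/q)/8`. -/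
def evalZ (p q : ℤ) (r : LitZ) : ZRow := r.map fun t => (t.1, 8 * q * t.2.1 + 4 * p * t.2.2)

/-- `zval` of the integer evaluation is `32q` times the rational value at `β₀ = p/q` (`q ≠ 0`). -/
theorem zval_evalZ (β₀ : ℚ) (p q : ℤ) (hq : q ≠ 0) (hβ : (p : ℚ) / q = β₀) (r : LitZ) :
    zval v (evalZ p q r) = 32 * (q : ℝ) * rowVal (β₀ : ℝ) v (litQ r) := by
  subst hβ
  induction r with
  | nil => simp [evalZ, litQ]
  | cons t r ih =>
    simp only [evalZ, litQ, List.map_cons, zval_cons, rowVal_cons] at ih ⊢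
    rw [ih]
    have hq' : (q : ℝ) ≠ 0 := by exact_mod_cast hq
    push_cast
    field_simp
    ring

/-! ## Coded problem rows and the integer check -/

/-- Term constructor `(label code, integer numerator)` (decoded coefficient = numerator / the row's `M`). -/
def tz (w : ℕ) (z : ℤ) : ℕ × ℤ := (w, z)

/-- Witness entry `(integer multiplier, literal def id, position)`. -/
def lz (m : ℤ) (i k : ℕ) : ℤ × ℕ × ℕ := (m, i, k)

/-- A CODED problem row: `(terms, M, K, witness)` — decoded coefficients `z / M`; the check certifies
`K • terms = Σ m • (32q · literal row at β)` with `K ≠ 0`. -/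
abbrev CRowZ : Type := List (ℕ × ℤ) × ℕ × ℤ × List (ℤ × ℕ × ℕ)

/-- The decoded word-keyed row of coded terms with denominator `M`: `(wdg d code, z / M, 0)`. -/
def decWZ (d : ℕ) [NeZero d] (ts : List (ℕ × ℤ)) (M : ℕ) : GRow (Word d) := ts.map fun t => (wdg d t.1, (t.2 : ℚ) / M, 0)

/-- The combination named by a witness over a family's coded literal rows, evaluated at `β = p/q`. -/
def comboZ (litZ : ℕ × ℕ → LitZ) (p q : ℤ) (idx : List (ℤ × ℕ × ℕ)) : List (ℤ × ZRow) :=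
  idx.map fun e => (e.1, evalZ p q (litZ e.2))

/-- **The integer kernel check at `β = p/q`**: `K ≠ 0` and the canonical form of `K • terms` equals that of the witness
combination of the evaluated literal rows. -/
def cchkZ (litZ : ℕ × ℕ → LitZ) (p q : ℤ) (c : CRowZ) : Bool :=
  (c.2.2.1 != 0) && decide (ZRow.mcanon (ZRow.smul c.2.2.1 c.1) = ZRow.mcanon (ZRow.lincomb (comboZ litZ p q c.2.2.2)))

variable {d : ℕ} [NeZero d] (β : ℝ) (W : Word d → ℝ)

/-- Valuation transport for decoded problem rows: `rowVal` of `decWZ d ts M` is `zval ts / M` under `n ↦ W (wdg d n)`. -/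
theorem rowVal_decWZ (ts : List (ℕ × ℤ)) (M : ℕ) :
    rowVal β W (decWZ d ts M) = zval (fun n => W (wdg d n)) ts / M := by
  induction ts with
  | nil => simp [decWZ]
  | cons t ts ih =>
    simp only [decWZ, List.map_cons, rowVal_cons, zval_cons] at ih ⊢
    rw [ih]; push_cast; ring

/-- **Soundness of the integer check, any valuation**: if every decoded literal row vanishes under `W` at `β₀ = p/q` (`q ≠ 0`)
and the coded row `c` passes `cchkZ litZ p q`, then its decoded row `decWZ d c.1 c.2.1` vanishes under `W` at `β₀`. -/
theorem rowVal_decWZ_eq_zero_of_cchkZ (litZ : ℕ × ℕ → LitZ) (β₀ : ℚ) (p q : ℤ) (hq : q ≠ 0) (hβ : (p : ℚ) / q = β₀)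
    (hlit : ∀ i, rowVal (β₀ : ℝ) W (decRowQ d (litQ (litZ i))) = 0) (c : CRowZ)
    (h : cchkZ litZ p q c = true) : rowVal (β₀ : ℝ) W (decWZ d c.1 c.2.1) = 0 := by
  simp only [cchkZ, Bool.and_eq_true, bne_iff_ne, ne_eq, decide_eq_true_eq] at h
  obtain ⟨hK, hcanon⟩ := h
  have hval := zval_eq_of_mcanon_eq (fun n => W (wdg d n)) _ _ hcanon
  rw [zval_smul, zval_lincomb_eq_zero] at hval
  · have hz : zval (fun n => W (wdg d n)) c.1 = 0 := by
      rcases mul_eq_zero.1 hval with h0 | h0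
      · exact absurd (by exact_mod_cast h0) hK
      · exact h0
    rw [rowVal_decWZ, hz, zero_div]
  · intro e he
    obtain ⟨x, _, rfl⟩ := List.mem_map.1 he
    show zval (fun n => W (wdg d n)) (evalZ p q (litZ x.2)) = 0
    rw [zval_evalZ _ β₀ p q hq hβ, rowVal_decRowQ, hlit x.2, mul_zero]

/-- List form. -/
theorem rowVal_decWZ_eq_zero_of_all_cchkZ (litZ : ℕ × ℕ → LitZ) (β₀ : ℚ) (p q : ℤ) (hq : q ≠ 0) (hβ : (p : ℚ) / q = β₀)
    (hlit : ∀ i, rowVal (β₀ : ℝ) W (decRowQ d (litQ (litZ i))) = 0) (E : List CRowZ)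
    (h : E.all (cchkZ litZ p q) = true) : ∀ c ∈ E, rowVal (β₀ : ℝ) W (decWZ d c.1 c.2.1) = 0 :=
  fun c hc => rowVal_decWZ_eq_zero_of_cchkZ W litZ β₀ p q hq hβ hlit c (List.all_eq_true.1 h c hc)

/-- Indexed form: row `j` of `E` (default: the empty row). -/
theorem rowVal_decWZ_getD_eq_zero_of_all_cchkZ (litZ : ℕ × ℕ → LitZ) (β₀ : ℚ) (p q : ℤ) (hq : q ≠ 0) (hβ : (p : ℚ) / q = β₀)
    (hlit : ∀ i, rowVal (β₀ : ℝ) W (decRowQ d (litQ (litZ i))) = 0) (E : List CRowZ)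
    (h : E.all (cchkZ litZ p q) = true) (j : ℕ) :
    rowVal (β₀ : ℝ) W (decWZ d (E.getD j ([], 0, 0, [])).1 (E.getD j ([], 0, 0, [])).2.1) = 0 := by
  by_cases hj : j < E.length
  · rw [List.getD_eq_getElem _ _ hj]
    exact rowVal_decWZ_eq_zero_of_all_cchkZ W litZ β₀ p q hq hβ hlit E h _ (List.getElem_mem hj)
  · rw [List.getD_eq_default _ _ (Nat.le_of_not_lt hj)]
    simp [decWZ]

/-- A literal-row table vanishes under `W` as soon as each of its lists does: `litZ (i, k) = (tables.getD i []).getD k []`. -/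
theorem hlitZ_of_tables (tables : List (List LitZ))
    (h : ∀ T ∈ tables, ∀ r ∈ T, rowVal β W (decRowQ d (litQ r)) = 0) (i : ℕ × ℕ) :
    rowVal β W (decRowQ d (litQ ((tables.getD i.1 []).getD i.2 []))) = 0 := by
  by_cases hi : i.1 < tables.length
  · rw [List.getD_eq_getElem _ _ hi]
    by_cases hk : i.2 < (tables[i.1]).length
    · rw [List.getD_eq_getElem _ _ hk]
      exact h _ (List.getElem_mem hi) _ (List.getElem_mem hk)
    · rw [List.getD_eq_default _ _ (Nat.le_of_not_lt hk)]; simp [decRowQ, litQ]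
  · rw [List.getD_eq_default _ _ (Nat.le_of_not_lt hi), List.getD_nil]; simp [decRowQ, litQ]

/-- Example (closed computation): at `β = 3/2` the literal row `{(∅, 4c0 = 4, c1 = 0), (□, 0, -1)}` evaluates to
`32·2·1 = 64` on `∅` and `4·3·(-1) = -12` on `□`; the problem row `(□, 3), (∅, -16)` with `M` arbitrary, `K = 4` and witness
`m = -1` passes the check. -/
example : cchkZ (fun _ => [ez 0 4 0, ez 1324 0 (-1)]) 3 2 ([tz 1324 3, tz 0 (-16)], 7, 4, [lz (-1) 0 0]) = true := by
  decide +kernel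

end Summit.QuantumFields.GaugeBoot.BindZ

end
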